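import Mathlib.Analysis.Complex.CauchyIntegral
import Literature.Analysis.Complex.HolomorphicParametricIntegral
import Literature.Analysis.Complex.HorizontalStripResidues
import Mathlib.Analysis.Distribution.SchwartzSpace.Fourier
import Mathlib.Analysis.SpecialFunctions.JapaneseBracket
import HarnessLib

/-!
# Paley–Wiener tools for the half-space spectral support of OS boundary values

Support file (everything proved) for the spectral half of (A2)
`OS1975_boundaryValue_of_timeContinuation` (`OSTimeContinuation`): the Fourier transform of the
time-ray boundary value of a time-holomorphic function of OS growth is supported in the half-space
spectral set. The mechanism is the classical Paley–Wiener argument in one complex variable along a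
temporal direction: a function `k` holomorphic and polynomially bounded on the closed upper
half-plane annihilates every Schwartz function whose Fourier transform is supported in `(0, ∞)`,
because such a function extends to the upper half-plane with rapid decay and the line of
integration can be pushed to `+i∞`. This file provides the two ingredients:

* `integral_eq_zero_of_norm_le_upperHalfPlane` — `∫ F(x) dx = 0` for `F` holomorphic on
  `{Im ≥ 0}` with `‖F λ‖ ≤ A (1 + ‖λ‖)^{-2}`: shift the line `Im = 0` to `Im = τ` with the tree's
  `Literature.Analysis.Complex.integral_horizontal_eq_of_continuousOn_of_differentiableOn`
  (`HorizontalStripResidues`) and let `τ → ∞`;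
* `laplaceExt g λ = ∫ e^{2πiwλ} g(w) dw` — the Fourier–Laplace extension of `𝓕⁻¹g`
  (`laplaceExt_ofReal`): entire for compactly supported `g` (`differentiable_laplaceExt`), bounded
  by `‖g‖₁` on `{Im ≥ 0}` when `supp g ⊆ [0, ∞)` (`norm_laplaceExt_le`), with
  `R[g'] = −2πiλ R[g]` (`laplaceExt_deriv`, integration by parts) and hence, for Schwartz `g` of
  compact support in `[0, ∞)`, `‖R(λ)‖ ≤ C_K (1 + ‖λ‖)^{-K}` on `{Im ≥ 0}` for every `K`
  (`exists_norm_laplaceExt_le`).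

## References

* R. F. Streater, A. S. Wightman, *PCT, Spin and Statistics, and All That* (1964), §2-3
  (Laplace transforms and supports), Thm. 2-8. [StreaterWightman1964]
* V. S. Vladimirov, *Methods of the Theory of Functions of Many Complex Variables* (1966), §26.
  [Vladimirov1966]
-/

noncomputable section

open Filter Topology Complex MeasureTheory Set Metric
open scoped SchwartzMap Real FourierTransform RealInnerProductSpace

namespace Literature.MathematicalPhysics.QuantumFieldTheory

/-! ### Pushing a horizontal line of integration to infinity -/

/-- **A horizontal line integral that can be pushed to infinity vanishes**: if `F` is
holomorphic on the closed upper half-plane `{Im ≥ 0}` with `‖F λ‖ ≤ A (1 + ‖λ‖)^{-2}` there, then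
`∫ F(x) dx = 0` (shift the line `Im = 0` to `Im = τ` and let `τ → ∞`). [folklore] -/
theorem integral_eq_zero_of_norm_le_upperHalfPlane (F : ℂ → ℂ)
    (hFd : DifferentiableOn ℂ F {l : ℂ | 0 ≤ l.im}) {A : ℝ}
    (hA : ∀ l : ℂ, 0 ≤ l.im → ‖F l‖ ≤ A * ((1 + ‖l‖) ^ 2)⁻¹) :
    ∫ x : ℝ, F x = 0 := by
  have hA0 : 0 ≤ A := by
    have h := hA 0 (by simp)
    have : (0 : ℝ) ≤ A * ((1 + ‖(0 : ℂ)‖) ^ 2)⁻¹ := (norm_nonneg _).trans h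
    simpa using this
  -- the majorant on horizontal lines
  have hmaj : Integrable fun x : ℝ => A * ((1 + ‖x‖) ^ 2)⁻¹ := by
    have h := (integrable_one_add_norm (E := ℝ) (μ := volume) (r := 2) (by norm_num [Module.finrank_self])).const_mul A
    refine h.congr (Eventually.of_forall fun x => ?_)
    simp only [Real.rpow_neg (by positivity : (0 : ℝ) ≤ 1 + ‖x‖), Real.rpow_two]
  have hline_bound : ∀ (τ : ℝ), 0 ≤ τ → ∀ x : ℝ, ‖F (x + τ * I)‖ ≤ A * ((1 + ‖x‖) ^ 2)⁻¹ := by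
    intro τ hτ x
    refine (hA _ (by simpa using hτ)).trans ?_
    refine mul_le_mul_of_nonneg_left (inv_anti₀ (by positivity) ?_) hA0
    refine pow_le_pow_left₀ (by positivity) ?_ 2
    have : ‖(x : ℂ)‖ ≤ ‖(x : ℂ) + τ * I‖ := by
      have h1 : |((x : ℂ) + τ * I).re| ≤ ‖(x : ℂ) + τ * I‖ := abs_re_le_norm _
      simpa using h1
    simpa using this
  have hcont : ∀ τ : ℝ, 0 ≤ τ → Continuous fun x : ℝ => F (x + τ * I) := fun τ hτ =>
    hFd.continuousOn.comp_continuous (by fun_prop) fun x => by simpa using hτ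
  have hint : ∀ τ : ℝ, 0 ≤ τ → Integrable fun x : ℝ => F (x + τ * I) := fun τ hτ =>
    hmaj.mono' (hcont τ hτ).aestronglyMeasurable (Eventually.of_forall (hline_bound τ hτ))
  -- shift the line `Im = 0` to `Im = τ`
  have hshift : ∀ τ : ℝ, 0 < τ → ∫ x : ℝ, F x = ∫ x : ℝ, F (x + τ * I) := by
    intro τ hτ
    have h := Literature.Analysis.Complex.integral_horizontal_eq_of_continuousOn_of_differentiableOn
      (F := F) hτ.le (hFd.continuousOn.mono fun z hz => (mem_Icc.1 (mem_preimage.1 hz)).1)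
      (hFd.mono fun z hz => (mem_Ioo.1 (mem_preimage.1 hz)).1.le)
      (by simpa using hint 0 le_rfl) (hint τ hτ.le) fun ε hε => ?_
    · simpa using h
    · -- decay at the ends of the strip
      obtain ⟨R₀, hR₀pos, hR₀⟩ : ∃ R₀ : ℝ, 0 < R₀ ∧ A * ((1 + R₀) ^ 2)⁻¹ ≤ ε := by
        refine ⟨A / ε + 1, by positivity, ?_⟩
        rw [← div_eq_mul_inv, div_le_iff₀ (by positivity)]
        have h1 : A ≤ ε * (A / ε + 1) := by
          rw [mul_add, mul_div_cancel₀ _ hε.ne']; linarith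
        nlinarith [sq_nonneg (A / ε + 1), hA0, hε]
      refine ⟨R₀, fun R hR τ' hτ' => ?_⟩
      refine (hline_bound τ' hτ'.1 R).trans (le_trans ?_ hR₀)
      refine mul_le_mul_of_nonneg_left (inv_anti₀ (by positivity) ?_) hA0
      exact pow_le_pow_left₀ (by positivity) (by rw [Real.norm_eq_abs]; linarith) 2
  -- `τ → ∞`: the shifted integrals tend to `0`
  have hlim : Tendsto (fun τ : ℝ => ∫ x : ℝ, F (x + τ * I)) atTop (𝓝 0) := by
    have h0 : (0 : ℂ) = ∫ _ : ℝ, (0 : ℂ) := by simp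
    rw [h0]
    refine tendsto_integral_filter_of_dominated_convergence (fun x : ℝ => A * ((1 + ‖x‖) ^ 2)⁻¹)
      ?_ ?_ hmaj ?_
    · filter_upwards [eventually_ge_atTop (0 : ℝ)] with τ hτ using (hcont τ hτ).aestronglyMeasurable
    · filter_upwards [eventually_ge_atTop (0 : ℝ)] with τ hτ using Eventually.of_forall (hline_bound τ hτ)
    · refine Eventually.of_forall fun x => ?_
      have hτlim : Tendsto (fun τ : ℝ => A * ((1 + τ) ^ 2)⁻¹) atTop (𝓝 0) := by
        have h1 : Tendsto (fun τ : ℝ => (1 + τ) ^ 2) atTop atTop :=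
          (tendsto_pow_atTop two_ne_zero).comp (tendsto_atTop_add_const_left atTop 1 tendsto_id)
        simpa using h1.inv_tendsto_atTop.const_mul A
      refine squeeze_zero_norm' ?_ hτlim
      filter_upwards [eventually_ge_atTop (0 : ℝ)] with τ hτ0
      refine (hA _ (by simpa using hτ0)).trans ?_
      refine mul_le_mul_of_nonneg_left (inv_anti₀ (by positivity) ?_) hA0
      refine pow_le_pow_left₀ (by positivity) ?_ 2
      have h1 : |((x : ℂ) + τ * I).im| ≤ ‖(x : ℂ) + τ * I‖ := abs_im_le_norm _
      have h2 : ((x : ℂ) + τ * I).im = τ := by simp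
      rw [h2, abs_of_nonneg hτ0] at h1
      linarith
  -- conclude
  have hconst : Tendsto (fun τ : ℝ => ∫ x : ℝ, F (x + τ * I)) atTop (𝓝 (∫ x : ℝ, F x)) := by
    refine tendsto_const_nhds.congr' ?_
    filter_upwards [eventually_gt_atTop (0 : ℝ)] with τ hτ using hshift τ hτ
  exact tendsto_nhds_unique hconst hlim

/-! ### The holomorphic extension of a function with one-sided compactly supported spectrum -/

/-- The **Fourier–Laplace extension** `R(λ) = ∫ e^{2πiwλ} g(w) dw` of `𝓕⁻¹g` to complex `λ`,
for a compactly supported `g` (Paley–Wiener: entire, and bounded on `{Im λ ≥ 0}` when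
`supp g ⊆ [0, ∞)`). [folklore] -/
def laplaceExt (g : ℝ → ℂ) (l : ℂ) : ℂ := ∫ w : ℝ, cexp (2 * π * I * w * l) * g w

/-- On the real axis the extension is the inverse Fourier transform. [folklore] -/
theorem laplaceExt_ofReal (g : ℝ → ℂ) (s : ℝ) : laplaceExt g s = 𝓕⁻ g s := by
  rw [laplaceExt, Real.fourierInv_eq']
  refine integral_congr_ae (Eventually.of_forall fun w => ?_)
  simp only [smul_eq_mul, RCLike.inner_apply, conj_trivial]
  congr 1
  push_cast
  ring_nf


/-- The kernel `w ↦ e^{2πiwλ}` has derivative `2πiλ e^{2πiwλ}`. [folklore] -/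
theorem hasDerivAt_cexp_kernel (l : ℂ) (w : ℝ) :
    HasDerivAt (fun w : ℝ => cexp (2 * π * I * w * l)) (2 * π * I * l * cexp (2 * π * I * w * l)) w := by
  have h1 : HasDerivAt (fun w : ℂ => cexp (2 * π * I * w * l)) (cexp (2 * π * I * w * l) * (2 * π * I * l)) w := by
    have h := ((hasDerivAt_id (w : ℂ)).const_mul (2 * π * I)).mul_const l
    simpa [mul_comm, mul_assoc, mul_left_comm] using (h.cexp)
  have h2 := h1.comp_ofReal
  convert h2 using 1
  ring

/-- The modulus of the kernel: `|e^{2πiwλ}| = e^{−2πw Im λ}`. [folklore] -/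
theorem norm_cexp_kernel (l : ℂ) (w : ℝ) : ‖cexp (2 * π * I * w * l)‖ = Real.exp (-2 * π * w * l.im) := by
  rw [Complex.norm_exp]
  congr 1
  have : (2 * π * I * w * l : ℂ) = ((2 * π * w : ℝ) : ℂ) * (I * l) := by push_cast; ring
  rw [this, Complex.re_ofReal_mul, Complex.I_mul_re]
  ring

/-- On `{Im λ ≥ 0}` and for `w ≥ 0` the kernel has modulus `≤ 1`. [folklore] -/
theorem norm_cexp_kernel_le_one {l : ℂ} (hl : 0 ≤ l.im) {w : ℝ} (hw : 0 ≤ w) :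
    ‖cexp (2 * π * I * w * l)‖ ≤ 1 := by
  rw [norm_cexp_kernel, Real.exp_le_one_iff]
  have : 0 ≤ 2 * π * w * l.im := by positivity
  linarith

/-- Local uniform bound of the kernel on the support: for `λ` in a ball and `w` in a compact set,
`|e^{2πiwλ}| ≤ e^{2π R (|Im λ₀| + r)}`. [folklore] -/
theorem norm_cexp_kernel_le_of_mem_ball {l₀ l : ℂ} {r : ℝ} (hl : l ∈ ball l₀ r) {w R : ℝ}
    (hw : |w| ≤ R) : ‖cexp (2 * π * I * w * l)‖ ≤ Real.exp (2 * π * R * (|l₀.im| + r)) := by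
  rw [norm_cexp_kernel, Real.exp_le_exp]
  have h1 : |l.im| ≤ |l₀.im| + r := by
    have h2 : |l.im - l₀.im| ≤ ‖l - l₀‖ := by simpa using abs_im_le_norm (l - l₀)
    have h3 : ‖l - l₀‖ < r := mem_ball_iff_norm.1 hl
    linarith [abs_sub_abs_le_abs_sub l.im l₀.im]
  have h4 : -(w * l.im) ≤ |w| * |l.im| := by
    rw [← abs_mul]; exact neg_le_abs (w * l.im)
  have hR : 0 ≤ R := (abs_nonneg w).trans hw
  have h5 : |w| * |l.im| ≤ R * (|l₀.im| + r) := mul_le_mul hw h1 (abs_nonneg _) hR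
  nlinarith [Real.pi_pos, h4, h5]

/-- **The Fourier–Laplace extension of a compactly supported integrable function is entire**
(dominated holomorphic parameter integral). [folklore] -/
theorem differentiable_laplaceExt {g : ℝ → ℂ} (hgc : HasCompactSupport g) (hg : Integrable g) :
    Differentiable ℂ (laplaceExt g) := by
  obtain ⟨R, hR⟩ := hgc.isCompact.isBounded.subset_closedBall 0
  have hsupp : ∀ w, g w ≠ 0 → |w| ≤ R := fun w hw => by
    simpa using hR (subset_tsupport _ hw)
  have hd : DifferentiableOn ℂ (laplaceExt g) univ := by
    refine Literature.Analysis.Complex.differentiableOn_integral_of_dominated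
      (F := fun (l : ℂ) (w : ℝ) => cexp (2 * π * I * w * l) * g w) (μ := volume) ?_ ?_ ?_
    · intro l _
      exact ((by fun_prop : Continuous fun w : ℝ => cexp (2 * π * I * w * l)).aestronglyMeasurable).mul
        hg.aestronglyMeasurable
    · refine Eventually.of_forall fun w => ?_
      exact (Differentiable.differentiableOn (by fun_prop)).mul (differentiableOn_const _)
    · intro l₀ _
      refine ⟨1, one_pos, subset_univ _, fun w => Real.exp (2 * π * R * (|l₀.im| + 1)) * ‖g w‖,
        hg.norm.const_mul _, Eventually.of_forall fun w l hl => ?_⟩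
      by_cases hw : g w = 0
      · simp [hw]
      · rw [norm_mul]
        exact mul_le_mul_of_nonneg_right (norm_cexp_kernel_le_of_mem_ball hl (hsupp w hw)) (norm_nonneg _)
  exact fun l => hd.differentiableAt (isOpen_univ.mem_nhds (mem_univ l))

/-- **Boundedness on the closed upper half-plane**: if `supp g ⊆ [0, ∞)` then
`‖R(λ)‖ ≤ ‖g‖_{L¹}` for `Im λ ≥ 0`. [folklore] -/
theorem norm_laplaceExt_le {g : ℝ → ℂ} (hg : Integrable g) (hg0 : tsupport g ⊆ Ici 0) {l : ℂ}
    (hl : 0 ≤ l.im) : ‖laplaceExt g l‖ ≤ ∫ w, ‖g w‖ := by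
  refine (norm_integral_le_integral_norm _).trans (integral_mono_of_nonneg
    (Eventually.of_forall fun _ => norm_nonneg _) hg.norm (Eventually.of_forall fun w => ?_))
  dsimp only
  by_cases hw : g w = 0
  · simp [hw]
  · rw [norm_mul]
    have hw0 : 0 ≤ w := hg0 (subset_tsupport _ hw)
    exact mul_le_of_le_one_left (norm_nonneg _) (norm_cexp_kernel_le_one hl hw0)

/-- **Integration by parts under the Fourier–Laplace extension**: for a Schwartz `g` of compact
support, `R[g'](λ) = −2πiλ · R[g](λ)`. [folklore] -/
theorem laplaceExt_deriv (g : 𝓢(ℝ, ℂ)) (hgc : HasCompactSupport g) (l : ℂ) :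
    laplaceExt (deriv g) l = -(2 * π * I * l) * laplaceExt g l := by
  unfold laplaceExt
  set u : ℝ → ℂ := fun w => cexp (2 * π * I * w * l) with hu
  set u' : ℝ → ℂ := fun w => 2 * π * I * l * cexp (2 * π * I * w * l) with hu'
  have huc : Continuous u := by rw [hu]; fun_prop
  have hu'c : Continuous u' := by rw [hu']; fun_prop
  have hgdc : HasCompactSupport (deriv g) := hgc.deriv
  -- the product `u g` vanishes at `±∞`
  obtain ⟨R, hR⟩ := hgc.isCompact.isBounded.subset_closedBall 0
  have hzero : ∀ w, R < |w| → (u * ⇑g) w = 0 := by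
    intro w hw
    have : g w = 0 := by
      by_contra h
      have := hR (subset_tsupport _ h)
      simp only [mem_closedBall, dist_zero_right, Real.norm_eq_abs] at this
      linarith
    simp [this]
  have h_top : Tendsto (u * ⇑g) atTop (𝓝 0) := by
    refine tendsto_const_nhds.congr' ?_
    filter_upwards [eventually_gt_atTop |R|] with w hw
    exact (hzero w ((le_abs_self R).trans_lt (hw.trans_le (le_abs_self w)))).symm
  have h_bot : Tendsto (u * ⇑g) atBot (𝓝 0) := by
    refine tendsto_const_nhds.congr' ?_
    filter_upwards [eventually_lt_atBot (-|R|)] with w hw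
    refine (hzero w ((le_abs_self R).trans_lt ?_)).symm
    have : -w > |R| := by linarith
    exact this.trans_le (neg_le_abs w)
  have hderg : ∀ w, HasDerivAt (⇑g) (deriv g w) w := fun w => g.differentiableAt.hasDerivAt
  have hdc : Continuous (deriv g) := (SchwartzMap.derivCLM ℂ ℂ g).continuous.congr
    fun w => SchwartzMap.derivCLM_apply (𝕜 := ℂ) g w
  have h := integral_mul_deriv_eq_deriv_mul (u := u) (u' := u') (v := ⇑g) (v' := deriv g)
    (fun w _ => hasDerivAt_cexp_kernel l w) (fun w _ => hderg w)
    ((huc.mul hdc).integrable_of_hasCompactSupport hgdc.mul_left)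
    ((hu'c.mul g.continuous).integrable_of_hasCompactSupport hgc.mul_left) h_bot h_top
  simp only [sub_zero, zero_sub] at h
  rw [h, ← integral_neg, ← integral_const_mul]
  refine integral_congr_ae (Eventually.of_forall fun w => ?_)
  simp only [hu']
  ring

/-- Iterated integration by parts: `R[g^{(K)}](λ) = (−2πiλ)^K R[g](λ)`. [folklore] -/
theorem laplaceExt_iterate_deriv (g : 𝓢(ℝ, ℂ)) (hgc : HasCompactSupport g) (l : ℂ) (K : ℕ) :
    laplaceExt ((SchwartzMap.derivCLM ℂ ℂ)^[K] g) l = (-(2 * π * I * l)) ^ K * laplaceExt g l := by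
  induction K generalizing g with
  | zero => simp
  | succ K ih =>
    rw [Function.iterate_succ_apply, ih _ ?_, pow_succ]
    · have h := laplaceExt_deriv g hgc l
      have hfun : (⇑(SchwartzMap.derivCLM ℂ ℂ g) : ℝ → ℂ) = deriv g :=
        funext fun w => SchwartzMap.derivCLM_apply (𝕜 := ℂ) g w
      rw [hfun, h]
      ring
    · have hfun : (⇑(SchwartzMap.derivCLM ℂ ℂ g) : ℝ → ℂ) = deriv g :=
        funext fun w => SchwartzMap.derivCLM_apply (𝕜 := ℂ) g w
      rw [hfun]
      exact hgc.deriv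

/-- The support of the iterated derivatives of a compactly supported Schwartz function. [folklore] -/
theorem tsupport_iterate_derivCLM_subset (g : 𝓢(ℝ, ℂ)) (K : ℕ) :
    tsupport (⇑((SchwartzMap.derivCLM ℂ ℂ)^[K] g)) ⊆ tsupport (⇑g) := by
  induction K generalizing g with
  | zero => simp
  | succ K ih =>
    rw [Function.iterate_succ_apply]
    refine (ih _).trans ?_
    have hfun : (⇑(SchwartzMap.derivCLM ℂ ℂ g) : ℝ → ℂ) = deriv g :=
      funext fun w => SchwartzMap.derivCLM_apply (𝕜 := ℂ) g w
    rw [hfun]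
    exact tsupport_deriv_subset

/-- Compact support of the iterated derivatives. [folklore] -/
theorem hasCompactSupport_iterate_derivCLM (g : 𝓢(ℝ, ℂ)) (hgc : HasCompactSupport g) (K : ℕ) :
    HasCompactSupport (⇑((SchwartzMap.derivCLM ℂ ℂ)^[K] g)) :=
  hgc.of_isClosed_subset (isClosed_tsupport _) (tsupport_iterate_derivCLM_subset g K)

/-- **Decay of the Fourier–Laplace extension on the closed upper half-plane**: for a Schwartz `g`
with compact support in `[0, ∞)` and every `K`, `‖R(λ)‖ ≤ C (1 + ‖λ‖)^{-K}` on `{Im λ ≥ 0}`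
(boundedness by `‖g‖₁`, and `K` integrations by parts, `|R(λ)| ≤ ‖g^{(K)}‖₁ (2π|λ|)^{-K}`). [folklore] -/
theorem exists_norm_laplaceExt_le (g : 𝓢(ℝ, ℂ)) (hgc : HasCompactSupport g)
    (hg0 : tsupport (⇑g) ⊆ Ici 0) (K : ℕ) :
    ∃ C : ℝ, 0 ≤ C ∧ ∀ l : ℂ, 0 ≤ l.im → ‖laplaceExt g l‖ ≤ C * ((1 + ‖l‖) ^ K)⁻¹ := by
  set gK : 𝓢(ℝ, ℂ) := (SchwartzMap.derivCLM ℂ ℂ)^[K] g with hgK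
  set A : ℝ := ∫ w, ‖g w‖ with hA
  set B : ℝ := ∫ w, ‖gK w‖ with hB
  have hA0 : 0 ≤ A := integral_nonneg fun _ => norm_nonneg _
  have hB0 : 0 ≤ B := integral_nonneg fun _ => norm_nonneg _
  refine ⟨2 ^ K * (A + B), by positivity, fun l hl => ?_⟩
  have hbA : ‖laplaceExt g l‖ ≤ A := norm_laplaceExt_le g.integrable hg0 hl
  have hbB : ‖laplaceExt gK l‖ ≤ B :=
    norm_laplaceExt_le gK.integrable ((tsupport_iterate_derivCLM_subset g K).trans hg0) hl
  have hiter : laplaceExt gK l = (-(2 * π * I * l)) ^ K * laplaceExt g l :=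
    laplaceExt_iterate_deriv g hgc l K
  have h1 : 0 < 1 + ‖l‖ := by positivity
  rw [← div_eq_mul_inv, le_div_iff₀ (pow_pos h1 K)]
  by_cases hl1 : ‖l‖ ≤ 1
  · -- small `λ`: use the bound by `A`
    calc ‖laplaceExt g l‖ * (1 + ‖l‖) ^ K ≤ A * 2 ^ K := by
          refine mul_le_mul hbA (pow_le_pow_left₀ h1.le (by linarith) K) (by positivity) hA0
      _ ≤ 2 ^ K * (A + B) := by nlinarith [pow_nonneg (zero_le_two (α := ℝ)) K]
  · -- large `λ`: `K` integrations by parts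
    push Not at hl1
    have hl0 : 0 < ‖l‖ := zero_lt_one.trans hl1
    have hnorm : ‖(-(2 * π * I * l)) ^ K‖ = (2 * π * ‖l‖) ^ K := by
      rw [norm_pow, norm_neg]
      simp [mul_assoc, abs_of_pos Real.pi_pos]
    have hkey : (2 * π * ‖l‖) ^ K * ‖laplaceExt g l‖ ≤ B := by
      rw [← hnorm, ← norm_mul, ← hiter]; exact hbB
    have h2 : (1 + ‖l‖) ^ K ≤ (2 * π * ‖l‖) ^ K * 2 ^ K := by
      rw [← mul_pow]
      refine pow_le_pow_left₀ h1.le ?_ K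
      nlinarith [Real.two_le_pi]
    calc ‖laplaceExt g l‖ * (1 + ‖l‖) ^ K ≤ ‖laplaceExt g l‖ * ((2 * π * ‖l‖) ^ K * 2 ^ K) :=
          mul_le_mul_of_nonneg_left h2 (norm_nonneg _)
      _ = ((2 * π * ‖l‖) ^ K * ‖laplaceExt g l‖) * 2 ^ K := by ring
      _ ≤ B * 2 ^ K := mul_le_mul_of_nonneg_right hkey (by positivity)
      _ ≤ 2 ^ K * (A + B) := by nlinarith [pow_nonneg (zero_le_two (α := ℝ)) K]

end Literature.MathematicalPhysics.QuantumFieldTheory
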